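import Literature.AlgebraicGeometry.ModuliOfAbelianVarieties.SiegelHeckeLink
import Literature.AlgebraicGeometry.ModuliOfAbelianVarieties.SiegelAdmissibleClassUnique
import Literature.AlgebraicGeometry.ModuliOfAbelianVarieties.SymplecticSimilitudeCoprimeInverse
import HarnessLib

/-!
# The multiplier of a `QuotientAdapted` Hecke link at principal representatives is a positive integer

Cell hodgecm-mathlib, seat B-p13 (g16); B-plan1 (g14) ruling 2026-08-29 21:19:02Z («`ν : ℕ` is recovered on the
(B) side from `QuotientAdapted` + ★ LACK-2 `exists_nat_eq_multiplier_of_typeForm_similitude`»).  PROOF lane: theorems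
only, no definition.

For a rational similitude `γ` of the type-`δ` form, `ᵗγ E_δ γ = ν E_δ` with `ν > 0` ((QA3) of ★ `QuotientAdapted`), which
maps the lattice `Λ_{r′}` into `Λ_r` ((QA1)), where `r ∈ K_δ(1)` is principal and `r′ = r·k` with `k ∈ K_δ(N)` ((QA5)) —
so that `Λ_r = Λ_{r′} = ℤ^{2g}` ([Milne ISV] §4, ★ `latticeOfGL_coe_eq_one_of_mem_principalLevelSubgroup_one`) and `γ`
is INTEGRAL — the multiplier `ν` is a positive INTEGER: compare the `(0, g)`-entries, `δ₁ = 1` ([Shimura IATAF] §3.2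
«`det β = b`»; the tree's ★ `exists_nat_eq_multiplier_of_typeForm_similitude`).  This is the integer `m = ν(γ)` the
socket-(B) heads of the Hecke link take as `(ν : ℕ)`.

References: [Milne2005ShimuraVarieties, §4 pp. 48–49, §6 Thm. 6.11 pp. 74–75]; [ShimuraIATAF1971, §3.2].
-/

noncomputable section

open Matrix
open Literature.NumberTheory.Adeles (latticeOfGL mem_latticeOfGL_one_iff)

namespace Literature.AlgebraicGeometry.ModuliOfAbelianVarieties

variable {g N N' : ℕ} {δ : Fin g → ℕ} {r r' : gspFinAdelic δ} {γ : GL (Fin g ⊕ Fin g) ℚ}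

/-- (QA5) at a principal `r`: the source representative `r′ = r·k`, `k ∈ K_δ(N) ≤ K_δ(1)`, is principal too.
[cite: Milne2005ShimuraVarieties, §4 pp. 48–49] -/
theorem QuotientAdapted.mem_principalLevelSubgroup_one (h : QuotientAdapted δ δ N N' r r' γ)
    (hr : r ∈ principalLevelSubgroup δ 1) : r' ∈ principalLevelSubgroup δ 1 := by
  obtain ⟨-, ⟨k, hk, hrk⟩, -⟩ := h
  have hr' : r' = r * k := Subtype.ext (by rw [Subgroup.coe_mul]; exact hrk)
  rw [hr']
  exact Subgroup.mul_mem _ hr (principalLevelSubgroup_anti δ (one_dvd N) hk)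

/-- (QA1) at principal representatives: `γ` is an INTEGRAL matrix (`Λ_r = Λ_{r′} = ℤ^{2g}`).
[cite: Milne2005ShimuraVarieties, §4 pp. 48–49] [cite: ShimuraIATAF1971, §3.2 (lattices `L g`)] -/
theorem QuotientAdapted.forall_exists_int_eq (h : QuotientAdapted δ δ N N' r r' γ)
    (hr : r ∈ principalLevelSubgroup δ 1) :
    ∀ i j, ∃ z : ℤ, (z : ℚ) = (γ : Matrix (Fin g ⊕ Fin g) (Fin g ⊕ Fin g) ℚ) i j := by
  have hr' := h.mem_principalLevelSubgroup_one hr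
  obtain ⟨-, -, hQA1, -⟩ := h
  have hΛr := latticeOfGL_coe_eq_one_of_mem_principalLevelSubgroup_one hr
  have hΛr' := latticeOfGL_coe_eq_one_of_mem_principalLevelSubgroup_one hr'
  refine forall_exists_int_eq_of_forall_mulVec fun v hv => ?_
  have hmem := hQA1 v (by rw [hΛr', mem_latticeOfGL_one_iff]; exact hv)
  rw [hΛr, mem_latticeOfGL_one_iff] at hmem
  exact hmem

/-- **The multiplier of a `QuotientAdapted` link at principal representatives is a positive integer**: there is
`m : ℕ`, `0 < m`, with `ᵗγ E_δ γ = m • E_δ` (the `(ν : ℕ)` the socket-(B) heads consume; `m = ν(γ)`).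
[cite: ShimuraIATAF1971, §3.2 («det β = b»)] [cite: Milne2005ShimuraVarieties, §6 Thm. 6.11 pp. 74–75] -/
theorem QuotientAdapted.exists_nat_multiplier (hδ : IsPolarizationType δ) (hg : 0 < g)
    (h : QuotientAdapted δ δ N N' r r' γ) (hr : r ∈ principalLevelSubgroup δ 1) :
    ∃ m : ℕ, 0 < m ∧ (γ : Matrix (Fin g ⊕ Fin g) (Fin g ⊕ Fin g) ℚ)ᵀ * typeFormOver δ ℚ *
      (γ : Matrix (Fin g ⊕ Fin g) (Fin g ⊕ Fin g) ℚ) = (m : ℚ) • typeFormOver δ ℚ := by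
  have hγ := h.forall_exists_int_eq hr
  obtain ⟨-, -, -, -, -, ν, hν, hsim⟩ := h
  obtain ⟨m, hm, hmν⟩ := exists_nat_eq_multiplier_of_typeForm_similitude hδ hg _ hγ hν hsim
  exact ⟨m, hm, by rw [hmν]; exact hsim⟩

/-- The same with the multiplier NAMED: if (QA3)'s similitude is witnessed by `ν`, then `ν = m` for some `0 < m : ℕ`
(uniqueness of the multiplier: `E_δ ≠ 0`). [cite: ShimuraIATAF1971, §3.2] [cite: Milne2005ShimuraVarieties, §6 Thm. 6.11 pp. 74–75] -/
theorem QuotientAdapted.exists_nat_cast_eq (hδ : IsPolarizationType δ) (hg : 0 < g)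
    (h : QuotientAdapted δ δ N N' r r' γ) (hr : r ∈ principalLevelSubgroup δ 1) {ν : ℚ}
    (hsim : (γ : Matrix (Fin g ⊕ Fin g) (Fin g ⊕ Fin g) ℚ)ᵀ * typeFormOver δ ℚ *
      (γ : Matrix (Fin g ⊕ Fin g) (Fin g ⊕ Fin g) ℚ) = ν • typeFormOver δ ℚ) :
    ∃ m : ℕ, 0 < m ∧ (m : ℚ) = ν := by
  obtain ⟨m, hm, hsim'⟩ := h.exists_nat_multiplier hδ hg hr
  refine ⟨m, hm, ?_⟩
  -- compare the `(inl 0, inr 0)` entries: `(E_δ)_{0, g} = δ₀ ≠ 0`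
  have hE : typeFormOver δ ℚ (Sum.inl ⟨0, hg⟩) (Sum.inr ⟨0, hg⟩) ≠ 0 := by
    rw [typeFormOver_apply, typeForm, Matrix.fromBlocks_apply₁₂, Matrix.diagonal_apply_eq]
    exact_mod_cast (hδ.1 ⟨0, hg⟩).ne'
  have h1 := congrFun (congrFun (hsim'.symm.trans hsim) (Sum.inl ⟨0, hg⟩)) (Sum.inr ⟨0, hg⟩)
  rw [Matrix.smul_apply, Matrix.smul_apply, smul_eq_mul, smul_eq_mul] at h1
  exact mul_right_cancel₀ hE h1

end Literature.AlgebraicGeometry.ModuliOfAbelianVarieties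

end
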